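import Summits.Ventures.PercRepro.Night2LocalD3TwoTwoB

/-!
# PercRepro — the cell `(a, k) = (2, 2)` at `|E ∖ G| = 3`, `q = 4`: the column bound closes (night-2, gen 13)

The assembly of `Night2LocalD3TwoTwoA/B.lean` (`proofs/NIGHT-2-dq3.md` §5.3).  At a far set `S` with `coloops S = K`, `|S| = 6`:

* the layer-1 request of a covering set `S ∖ v` is at most `3/5` when no pair member is fat (`L1_erase_le_of_no_fat`), at most
  `16/25` in general when a fat pair member `F` exists (`L1_erase_le_of_fat`: the three deletions are pair members, at most one of
  them is `F`), and at most `2/5` at `S ∖ v` for `v ∈ F ∖ K` (`L1_erase_le_of_mem_fat`: the deletion `K ∪ (S ∖ F)` is no member);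
* hence every `w₂ ≤ 1/15` without a fat member, and with one: `w₂(F) ≤ 18/100`, `w₂(B) ≤ 3/80` for the other members
  (one of the two covering sets of `B` is `S ∖ v` with `v ∈ F ∖ K`, where nothing is lost);
* with `#ex2 ≤ 6`: **`load2_le_cap2_two_two`** — every far set with two coloops satisfies `load₂(S) ≤ cap₂(S)`.
-/

open scoped Matroid

namespace PercRepro.Shadow

open Finset PerFlat ThmH

variable {α : Type*} [DecidableEq α] {M : Matroid α} [M.Finite]

section TwoTwoC

variable {G S : Finset α}

/-- `(S ∖ v) ∖ K` has three elements when `|S| = 6`, `K ⊆ S`, `|K| = 2`, `v ∈ S ∖ K`. -/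
theorem card_erase_sdiff_K (hS6 : S.card = 6) (hk : kColoops M G = 2)
    (hKS : G.filter (fun y => y ∉ clF M (G.erase y)) ⊆ S) {v : α}
    (hv : v ∈ S \ G.filter (fun y => y ∉ clF M (G.erase y))) :
    ((S.erase v) \ G.filter (fun y => y ∉ clF M (G.erase y))).card = 3 := by
  have hvS : v ∈ S := (Finset.mem_sdiff.1 hv).1
  have hvK : v ∉ G.filter (fun y => y ∉ clF M (G.erase y)) := (Finset.mem_sdiff.1 hv).2
  have hKsub : G.filter (fun y => y ∉ clF M (G.erase y)) ⊆ S.erase v :=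
    fun e he => Finset.mem_erase.2 ⟨fun h => hvK (h ▸ he), hKS he⟩
  have := Finset.card_sdiff_add_card_eq_card hKsub
  rw [Finset.card_erase_of_mem hvS, hS6] at this
  have hKc : (G.filter (fun y => y ∉ clF M (G.erase y))).card = 2 := hk
  omega

open scoped Classical in
/-- The covering set `S ∖ v` of a six-element far set is a shadow set with closure `G`. -/
theorem erase_mem_shadowAt_of_pair (hG : G ∈ flatsQ M (4 + 1))
    {B : Finset α} (hB : B ∈ ex2 M 4 G S) {z z' : α} (hP : S \ B = {z, z'}) (hzz' : z ≠ z') :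
    S.erase z' ∈ shadowAt M (4 + 2) 4 (Uq M (4 + 2) 4) G := by
  obtain ⟨hBm, -, hBS, hsub, -⟩ := mem_ex2_unpack hB
  have hz : z ∈ S \ B := by rw [hP]; exact Finset.mem_insert_self _ _
  rw [erase_eq_insert_of_sdiff_pair hBS hP hzz']
  exact insert_mem_shadowAt (Finset.Subset.refl _) hG hBm (hsub hz)

open scoped Classical in
/-- **No fat pair member**: `L₁(S ∖ v) ≤ 3/5` for every `v ∈ S ∖ K`. -/
theorem L1_erase_le_of_no_fat (hG : G ∈ flatsQ M (4 + 1)) (hd : (gr M \ G).card = 3) (hk : kColoops M G = 2)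
    (hS : S ∈ shadowAt M (4 + 2) 4 (Uq M (4 + 2) 4) G) (hS6 : S.card = 6)
    (hcol : coloops M S = G.filter (fun y => y ∉ clF M (G.erase y)))
    (hnofat : ∀ B ∈ membersIn M (Uq M (4 + 2) 4) G, G.filter (fun y => y ∉ clF M (G.erase y)) ⊆ B → B ⊆ S →
      (S \ B).card = 2 → ¬ (G \ S ⊆ clF M B))
    {v : α} (hv : v ∈ S \ G.filter (fun y => y ∉ clF M (G.erase y)))
    (hSv : S.erase v ∈ shadowAt M (4 + 2) 4 (Uq M (4 + 2) 4) G) : L1 M 4 G (S.erase v) ≤ 3 / 5 := by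
  have hKS : G.filter (fun y => y ∉ clF M (G.erase y)) ⊆ S := hcol ▸ coloops_subset_self S
  refine (L1_le_sum_erase hG hd hSv).trans ?_
  calc ∑ t ∈ (S.erase v) \ G.filter (fun y => y ∉ clF M (G.erase y)),
        (if (S.erase v).erase t ∈ membersIn M (Uq M (4 + 2) 4) G then req M 4 ((S.erase v).erase t) else 0)
      ≤ ∑ _t ∈ (S.erase v) \ G.filter (fun y => y ∉ clF M (G.erase y)), (1 / 5 : ℚ) := by
        apply Finset.sum_le_sum
        intro t ht
        split_ifs with hm
        · obtain ⟨hK, hsub, hcard⟩ := pair_shape_of_erase_erase hcol hv ht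
          exact (req_pair_le hG hd hS hS6 hcol hm hK hsub hcard).2.1 (hnofat _ hm hK hsub hcard)
        · norm_num
    _ = 3 / 5 := by rw [Finset.sum_const, card_erase_sdiff_K hS6 hk hKS hv]; norm_num

open scoped Classical in
/-- **A fat pair member `F`**: `L₁(S ∖ v) ≤ 16/25` for every `v ∈ S ∖ K` (the three deletions are pair members, at most one is `F`). -/
theorem L1_erase_le_of_fat (hs : ∀ e ∈ gr M, ∀ f ∈ gr M, e ≠ f → rkN M {e, f} = 2) (hG : G ∈ flatsQ M (4 + 1))
    (hd : (gr M \ G).card = 3) (hk : kColoops M G = 2) (hS : S ∈ shadowAt M (4 + 2) 4 (Uq M (4 + 2) 4) G)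
    (hS6 : S.card = 6) (hcol : coloops M S = G.filter (fun y => y ∉ clF M (G.erase y))) {F : Finset α}
    (hF : F ∈ membersIn M (Uq M (4 + 2) 4) G) (hKF : G.filter (fun y => y ∉ clF M (G.erase y)) ⊆ F) (hFS : F ⊆ S)
    (hFc : (S \ F).card = 2) (hfat : G \ S ⊆ clF M F) {v : α}
    (hv : v ∈ S \ G.filter (fun y => y ∉ clF M (G.erase y)))
    (hSv : S.erase v ∈ shadowAt M (4 + 2) 4 (Uq M (4 + 2) 4) G) : L1 M 4 G (S.erase v) ≤ 16 / 25 := by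
  have hKS : G.filter (fun y => y ∉ clF M (G.erase y)) ⊆ S := hcol ▸ coloops_subset_self S
  set T' := (S.erase v) \ G.filter (fun y => y ∉ clF M (G.erase y)) with hT'def
  refine (L1_le_sum_erase hG hd hSv).trans ?_
  have hterm : ∀ t ∈ T',
      (if (S.erase v).erase t ∈ membersIn M (Uq M (4 + 2) 4) G then req M 4 ((S.erase v).erase t) else 0) ≤
        1 / 5 + (if (S.erase v).erase t = F then (1 / 25 : ℚ) else 0) := by
    intro t ht
    split_ifs with hm hF' hF'
    · have := (req_pair_le hG hd hS hS6 hcol hF hKF hFS hFc).1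
      rw [hF']; linarith
    · obtain ⟨hK, hsub, hcard⟩ := pair_shape_of_erase_erase hcol hv ht
      have hnot : ¬ (G \ S ⊆ clF M ((S.erase v).erase t)) := fun h =>
        not_two_fat_pairs hs hG hd hk hS hS6 hcol hm hF hK hKF hsub hFS hcard hFc hF' h hfat
      have := (req_pair_le hG hd hS hS6 hcol hm hK hsub hcard).2.1 hnot
      linarith
    · norm_num
    · norm_num
  calc ∑ t ∈ T', (if (S.erase v).erase t ∈ membersIn M (Uq M (4 + 2) 4) G then req M 4 ((S.erase v).erase t) else 0)
      ≤ ∑ t ∈ T', (1 / 5 + (if (S.erase v).erase t = F then (1 / 25 : ℚ) else 0)) := Finset.sum_le_sum hterm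
    _ = 3 / 5 + (1 / 25) * ((T'.filter (fun t => (S.erase v).erase t = F)).card : ℚ) := by
        rw [Finset.sum_add_distrib, Finset.sum_const, card_erase_sdiff_K hS6 hk hKS hv, Finset.sum_ite,
          Finset.sum_const_zero, add_zero, Finset.sum_const, nsmul_eq_mul, nsmul_eq_mul]
        ring
    _ ≤ 3 / 5 + (1 / 25) * 1 := by
        have h1 : (T'.filter (fun t => (S.erase v).erase t = F)).card ≤ 1 := by
          rw [Finset.card_le_one]
          intro a ha b hb
          rw [Finset.mem_filter] at ha hb
          have haS : a ∈ S.erase v := (Finset.mem_sdiff.1 ha.1).1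
          have hbS : b ∈ S.erase v := (Finset.mem_sdiff.1 hb.1).1
          exact Finset.erase_injOn (S.erase v) haS hbS (ha.2.trans hb.2.symm)
        have : ((T'.filter (fun t => (S.erase v).erase t = F)).card : ℚ) ≤ 1 := by exact_mod_cast h1
        linarith
    _ = 16 / 25 := by norm_num

open scoped Classical in
/-- **At `S ∖ v` with `v ∈ F ∖ K` nothing is requested beyond `2/5`**: the deletion through the other point of `F ∖ K` is
`K ∪ (S ∖ F)`, no member, and the two others are thin. -/
theorem L1_erase_le_of_mem_fat (hs : ∀ e ∈ gr M, ∀ f ∈ gr M, e ≠ f → rkN M {e, f} = 2) (hG : G ∈ flatsQ M (4 + 1))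
    (hd : (gr M \ G).card = 3) (hk : kColoops M G = 2) (hS : S ∈ shadowAt M (4 + 2) 4 (Uq M (4 + 2) 4) G)
    (hS6 : S.card = 6) (hcol : coloops M S = G.filter (fun y => y ∉ clF M (G.erase y))) {F : Finset α}
    (hF : F ∈ membersIn M (Uq M (4 + 2) 4) G) (hKF : G.filter (fun y => y ∉ clF M (G.erase y)) ⊆ F) (hFS : F ⊆ S)
    (hFc : (S \ F).card = 2) (hfat : G \ S ⊆ clF M F) {v : α} (hvF : v ∈ F)
    (hv : v ∈ S \ G.filter (fun y => y ∉ clF M (G.erase y)))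
    (hSv : S.erase v ∈ shadowAt M (4 + 2) 4 (Uq M (4 + 2) 4) G) : L1 M 4 G (S.erase v) ≤ 2 / 5 := by
  have hSG : S ⊆ G := subset_of_mem_shadowAt hS
  set K := G.filter (fun y => y ∉ clF M (G.erase y)) with hKdef
  set T' := (S.erase v) \ K with hT'def
  refine (L1_le_sum_erase hG hd hSv).trans ?_
  have hterm : ∀ t ∈ T',
      (if (S.erase v).erase t ∈ membersIn M (Uq M (4 + 2) 4) G then req M 4 ((S.erase v).erase t) else 0) ≤
        (if t ∈ F then (0 : ℚ) else 1 / 5) := by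
    intro t ht
    obtain ⟨hK, hsub, hcard⟩ := pair_shape_of_erase_erase hcol hv ht
    have htS : t ∈ S.erase v := (Finset.mem_sdiff.1 ht).1
    by_cases htF : t ∈ F
    · rw [if_pos htF]
      -- `(S ∖ v) ∖ t = K ∪ (S ∖ F)` is no member
      have hnot : (S.erase v).erase t ∉ Uq M (4 + 2) 4 := by
        apply not_mem_Uq_of_sdiff_subset_clF hG hd hk hF hKF hK
        intro e he
        rw [Finset.mem_sdiff, Finset.mem_erase, Finset.mem_erase] at he
        by_cases heS : e ∈ S
        · -- `e ∈ {v, t} ⊆ F ⊆ cl F`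
          have : e = t ∨ e = v := by
            by_contra hne
            rw [not_or] at hne
            exact he.2 ⟨hne.1, hne.2, heS⟩
          have hFcl : F ⊆ clF M F := subset_clF (mem_membersIn.1 hF).1
          rcases this with rfl | rfl
          · exact hFcl htF
          · exact hFcl hvF
        · exact hfat (Finset.mem_sdiff.2 ⟨he.1, heS⟩)
      rw [if_neg (fun hm => hnot (mem_membersIn.1 hm).1)]
    · rw [if_neg htF]
      split_ifs with hm
      · have hne : (S.erase v).erase t ≠ F := by
          intro h
          have : v ∈ (S.erase v).erase t := h ▸ hvF
          exact (Finset.mem_erase.1 (Finset.mem_erase.1 this).2).1 rfl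
        have hnot : ¬ (G \ S ⊆ clF M ((S.erase v).erase t)) := fun h =>
          not_two_fat_pairs hs hG hd hk hS hS6 hcol hm hF hK hKF hsub hFS hcard hFc hne h hfat
        exact (req_pair_le hG hd hS hS6 hcol hm hK hsub hcard).2.1 hnot
      · norm_num
  calc ∑ t ∈ T', (if (S.erase v).erase t ∈ membersIn M (Uq M (4 + 2) 4) G then req M 4 ((S.erase v).erase t) else 0)
      ≤ ∑ t ∈ T', (if t ∈ F then (0 : ℚ) else 1 / 5) := Finset.sum_le_sum hterm
    _ = (1 / 5) * ((T'.filter (fun t => t ∉ F)).card : ℚ) := by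
        rw [Finset.sum_ite, Finset.sum_const_zero, zero_add, Finset.sum_const, nsmul_eq_mul]
        ring
    _ ≤ (1 / 5) * 2 := by
        have h1 : (T'.filter (fun t => t ∉ F)).card ≤ 2 := by
          refine le_trans (Finset.card_le_card ?_) (le_of_eq hFc)
          intro t ht
          rw [Finset.mem_filter] at ht
          exact Finset.mem_sdiff.2 ⟨(Finset.mem_erase.1 (Finset.mem_sdiff.1 ht.1).1).2, ht.2⟩
        have : ((T'.filter (fun t => t ∉ F)).card : ℚ) ≤ 2 := by exact_mod_cast h1
        linarith
    _ = 2 / 5 := by norm_num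

end TwoTwoC

end PercRepro.Shadow
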